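import Mathlib.Tactic.Positivity
import Mathlib.Tactic.FieldSimp
import Summits.Ventures.CertifiedArithmetic.LowPrec.SRKahan
import Summits.Ventures.CertifiedArithmetic.LowPrec.SREnvelopes
import HarnessLib

/-!
# Stochastic rounding into a finite format, XXX: compensated summation — envelopes, Chebyshev,
# sure bound, decidability

HONEST FRAMING: certified error envelopes and provably optimal rounding/accumulation schemes for
low-precision formats under stated cost models; every table by two implementations; no hardware or
vendor claims.

Companion of `SRKahan` (compensated summation executed under saturating mode-2 SR into a finite
format `F`; corrected value `sₙ − cₙ`). With `cgap F e = ⌈ē⌉ − ⌊ē⌋` the candidate gap of the clamped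
pre-rounding value `ē = clamp F e` and `GapK Gy Gd Gc` the path predicate "every y-op has candidate
gap `≤ Gy`, every d-op `≤ Gd`, every c-op `≤ Gc`" (the large additions are unconstrained):

* `kahanVar_le` — **variance envelope** `kahanVar ≤ n (Gy² + Gd² + Gc²)/4`: the standard
  deviation of the corrected sum grows like `√n` times the spacing AT THE SUMMANDS' MAGNITUDE, not
  at the partial sums' (contrast `accVar_le`: `n G²/4` with `G` the gap at partial-sum magnitude);
* `kahan_prob_dev_ge_le_kahanVar`, `kahan_prob_dev_ge_le` — Bienaymé–Chebyshev:
  `P(|sₙ − cₙ − (s − c + ∑ xₖ)| ≥ r) ≤ kahanVar/r² ≤ n (Gy² + Gd² + Gc²)/(4r²)`;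
* `leavesK_abs_sub_le` — the sure bound `|sₙ − cₙ − (s − c + ∑ xₖ)| ≤ n (Gy + Gd + Gc)` on every
  branch (linear growth, for contrast), from the pathwise identity
  `t − c' = (s − c) + x + εʸ − εᵈ − εᶜ`;
* Boolean evaluators `smallOpsB`, `leavesKB` and decidability of `SmallOps` / `NoSatK` / `GapK` /
  `LeavesK` (kernel certificates in `SRKahanFormats`).

References: [Higham2002, §4.3]; [ConnollyHighamMary2021] §3–4; [ArarEtAl2023] §3 (variance +
Bienaymé–Chebyshev method); [CastroEtAl2024]. The finite-format statements with saturation are this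
venture's additions.
-/

namespace Summit.Ventures.CertifiedArithmetic.LowPrec.SR

open Literature.ComputerArithmetic.ConnollyHighamMary2021
open Finset

variable {K : Type*} [Field K] [LinearOrder K] [IsStrictOrderedRing K]

/-! ### Boolean evaluators (kernel certificates) and decidability -/

/-- Boolean form of `OnBoth`. -/
def onBothB (F : Finset K) (e : K) (P : K → Bool) : Bool := P (up F e) && P (dn F e)

/-- Boolean form of `StepAll`. -/
def stepAllB (F : Finset K) (x s c : K) (P : K → K → Bool) : Bool :=
  onBothB F (x - c) fun y => onBothB F (s + y) fun t => onBothB F (t - s) fun d =>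
    onBothB F (d - y) fun c' => P t c'

/-- Boolean form of `StepSmall` for decidable predicates. -/
def stepSmallB (F : Finset K) (Py Pd Pc : K → Prop) [DecidablePred Py] [DecidablePred Pd]
    [DecidablePred Pc] (x s c : K) : Bool :=
  decide (Py (x - c)) && onBothB F (x - c) fun y => onBothB F (s + y) fun t =>
    decide (Pd (t - s)) && onBothB F (t - s) fun d => decide (Pc (d - y))

/-- Boolean evaluator of `SmallOps` (clean kernel reduction for `decide` certificates). -/
def smallOpsB (F : Finset K) (Py Pd Pc : K → Prop) [DecidablePred Py] [DecidablePred Pd]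
    [DecidablePred Pc] : (ℕ → K) → ℕ → K → K → Bool
  | _, 0, _, _ => true
  | x, n + 1, s, c => stepSmallB F Py Pd Pc (x 0) s c
      && stepAllB F (x 0) s c (smallOpsB F Py Pd Pc (fun i => x (i + 1)) n)

omit [IsStrictOrderedRing K] in
/-- `smallOpsB` computes `SmallOps`. -/
theorem smallOpsB_iff (F : Finset K) (Py Pd Pc : K → Prop) [DecidablePred Py] [DecidablePred Pd]
    [DecidablePred Pc] (x : ℕ → K) (n : ℕ) (s c : K) :
    smallOpsB F Py Pd Pc x n s c = true ↔ SmallOps F Py Pd Pc x n s c := by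
  induction n generalizing x s c with
  | zero => simp [smallOpsB, SmallOps]
  | succ n ih =>
      simp [smallOpsB, SmallOps, stepSmallB, StepSmall, stepAllB, StepAll, onBothB, OnBoth, ih,
        Bool.and_eq_true]

/-- `SmallOps` is decidable for decidable predicates (via `smallOpsB`). -/
instance instDecidableSmallOps (F : Finset K) (Py Pd Pc : K → Prop) [DecidablePred Py]
    [DecidablePred Pd] [DecidablePred Pc] (x : ℕ → K) (n : ℕ) (s c : K) :
    Decidable (SmallOps F Py Pd Pc x n s c) :=
  decidable_of_iff _ (smallOpsB_iff F Py Pd Pc x n s c)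

/-- `NoSatK` is decidable. -/
instance instDecidableNoSatK (F : Finset K) (x : ℕ → K) (n : ℕ) (s c : K) :
    Decidable (NoSatK F x n s c) :=
  inferInstanceAs (Decidable (SmallOps F (InHull F) (InHull F) (InHull F) x n s c))

/-- `LeavesK F x n P s c`: every leaf state `(sₙ, cₙ)` of the outcome tree satisfies `P`. -/
def LeavesK (F : Finset K) : (ℕ → K) → ℕ → (K → K → Prop) → K → K → Prop
  | _, 0, P, s, c => P s c
  | x, n + 1, P, s, c => StepAll F (x 0) s c (LeavesK F (fun i => x (i + 1)) n P)

/-- Boolean evaluator of `LeavesK` for a decidable predicate. -/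
def leavesKB (F : Finset K) (P : K → K → Prop) [∀ s c, Decidable (P s c)] :
    (ℕ → K) → ℕ → K → K → Bool
  | _, 0, s, c => decide (P s c)
  | x, n + 1, s, c => stepAllB F (x 0) s c (leavesKB F P (fun i => x (i + 1)) n)

omit [IsStrictOrderedRing K] in
/-- `leavesKB` computes `LeavesK`. -/
theorem leavesKB_iff (F : Finset K) (P : K → K → Prop) [∀ s c, Decidable (P s c)] (x : ℕ → K)
    (n : ℕ) (s c : K) : leavesKB F P x n s c = true ↔ LeavesK F x n P s c := by
  induction n generalizing x s c with
  | zero => simp [leavesKB, LeavesK]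
  | succ n ih => simp [leavesKB, LeavesK, stepAllB, StepAll, onBothB, OnBoth, ih, Bool.and_eq_true]

/-- `LeavesK` is decidable for a decidable predicate (via `leavesKB`). -/
instance instDecidableLeavesK (F : Finset K) (P : K → K → Prop) [∀ s c, Decidable (P s c)]
    (x : ℕ → K) (n : ℕ) (s c : K) : Decidable (LeavesK F x n P s c) :=
  decidable_of_iff _ (leavesKB_iff F P x n s c)

omit [IsStrictOrderedRing K] in
/-- `LeavesK` is monotone in the predicate. -/
theorem LeavesK.mono (F : Finset K) (x : ℕ → K) (n : ℕ) {P Q : K → K → Prop}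
    (hPQ : ∀ s c, P s c → Q s c) (s c : K) (h : LeavesK F x n P s c) : LeavesK F x n Q s c := by
  induction n generalizing x s c with
  | zero => exact hPQ s c h
  | succ n ih => exact StepAll.mono (fun t c' => ih _ t c') h

omit [Field K] [IsStrictOrderedRing K] in
/-- Conjunction of two `OnBoth` facts. -/
theorem OnBoth.and {F : Finset K} {e : K} {P Q : K → Prop} (hP : OnBoth F e P) (hQ : OnBoth F e Q) :
    OnBoth F e fun v => P v ∧ Q v :=
  ⟨⟨hP.1, hQ.1⟩, ⟨hP.2, hQ.2⟩⟩

/-! ### Candidate gaps of the small operations and the variance envelope -/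

/-- Candidate gap `⌈ē⌉ − ⌊ē⌋` of the clamped pre-rounding value `ē = clamp F e`. -/
def cgap (F : Finset K) (e : K) : K := roundUp F (clamp F e) - roundDown F (clamp F e)

/-- `GapK F Gy Gd Gc x n s c`: on every branch every y-op has candidate gap `≤ Gy`, every d-op
`≤ Gd`, every c-op `≤ Gc` (decidable; nothing is asked of the large additions). -/
def GapK (F : Finset K) (Gy Gd Gc : K) : (ℕ → K) → ℕ → K → K → Prop :=
  SmallOps F (fun e => cgap F e ≤ Gy) (fun e => cgap F e ≤ Gd) (fun e => cgap F e ≤ Gc)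

/-- `GapK` is decidable. -/
instance instDecidableGapK (F : Finset K) (Gy Gd Gc : K) (x : ℕ → K) (n : ℕ) (s c : K) :
    Decidable (GapK F Gy Gd Gc x n s c) := by
  unfold GapK; infer_instance

/-- One-step conditional variance from a candidate-gap bound: `v_F(clamp e) ≤ G²/4`. -/
theorem srVar_clamp_le_of_cgap {F : Finset K} {e G : K} (h : cgap F e ≤ G) :
    srVar F (clamp F e) ≤ G ^ 2 / 4 := by
  refine (srVar_le_gap_sq_div_four F _).trans ?_
  have h0 : 0 ≤ roundUp F (clamp F e) - roundDown F (clamp F e) :=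
    sub_nonneg.mpr (roundDown_le_roundUp F _)
  have := mul_self_le_mul_self h0 h
  nlinarith [this]

/-- A `kahanStep` expectation is bounded by any common bound at the reachable states. -/
theorem kahanStep_le_of (F : Finset K) (x s c : K) {g : K → K → K} {a : K}
    (h : StepAll F x s c fun t c' => g t c' ≤ a) : kahanStep F x s c g ≤ a :=
  step_le_of F _ (step_le_of F _ (step_le_of F _ (step_le_of F _ h.1.1.1.1 h.1.1.1.2)
    (step_le_of F _ h.1.1.2.1 h.1.1.2.2)) (step_le_of F _ (step_le_of F _ h.1.2.1.1 h.1.2.1.2)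
    (step_le_of F _ h.1.2.2.1 h.1.2.2.2)))
    (step_le_of F _ (step_le_of F _ (step_le_of F _ h.2.1.1.1 h.2.1.1.2)
    (step_le_of F _ h.2.1.2.1 h.2.1.2.2)) (step_le_of F _ (step_le_of F _ h.2.2.1.1 h.2.2.1.2)
    (step_le_of F _ h.2.2.2.1 h.2.2.2.2)))

/-- **One-step variance envelope**: `localVar ≤ (Gy² + Gd² + Gc²)/4` from the candidate gaps of the
three small operations. -/
theorem localVar_le {F : Finset K} {x s c Gy Gd Gc : K}
    (h : StepSmall F (fun e => cgap F e ≤ Gy) (fun e => cgap F e ≤ Gd) (fun e => cgap F e ≤ Gc)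
      x s c) : localVar F x s c ≤ (Gy ^ 2 + Gd ^ 2 + Gc ^ 2) / 4 := by
  obtain ⟨gy, hrest⟩ := h
  have hin : ∀ y t, (cgap F (t - s) ≤ Gd ∧ OnBoth F (t - s) fun d => cgap F (d - y) ≤ Gc) →
      innerVar F s y t ≤ Gd ^ 2 / 4 + Gc ^ 2 / 4 := by
    intro y t ⟨gd, gc⟩
    unfold innerVar
    exact add_le_add (srVar_clamp_le_of_cgap gd)
      (step_le_of F _ (srVar_clamp_le_of_cgap gc.1) (srVar_clamp_le_of_cgap gc.2))
  have hout : (step F (x - c) fun y => step F (s + y) fun t => innerVar F s y t)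
      ≤ Gd ^ 2 / 4 + Gc ^ 2 / 4 :=
    step_le_of F _ (step_le_of F _ (hin _ _ hrest.1.1) (hin _ _ hrest.1.2))
      (step_le_of F _ (hin _ _ hrest.2.1) (hin _ _ hrest.2.2))
  unfold localVar
  have := srVar_clamp_le_of_cgap gy
  linarith

/-- The accumulated variance is nonnegative. -/
theorem kahanVar_nonneg (F : Finset K) (x : ℕ → K) (n : ℕ) (s c : K) : 0 ≤ kahanVar F x n s c := by
  induction n generalizing x s c with
  | zero => exact le_rfl
  | succ n ih =>
      simp only [kahanVar]
      have hloc : 0 ≤ localVar F (x 0) s c := by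
        unfold localVar innerVar
        refine add_nonneg (srVar_nonneg F _) ?_
        have h1 := step_mono F (x 0 - c) (f := fun _ => (0 : K)) (g := fun y =>
          step F (s + y) fun t => srVar F (clamp F (t - s))
            + step F (t - s) fun d => srVar F (clamp F (d - y))) fun y => by
          have h2 := step_mono F (s + y) (f := fun _ => (0 : K)) (g := fun t =>
            srVar F (clamp F (t - s)) + step F (t - s) fun d => srVar F (clamp F (d - y)))
            fun t => add_nonneg (srVar_nonneg F _) (by
              have h3 := step_mono F (t - s) (f := fun _ => (0 : K))
                (g := fun d => srVar F (clamp F (d - y))) fun d => srVar_nonneg F _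
              rwa [step_const] at h3)
          rwa [step_const] at h2
        rwa [step_const] at h1
      have hst : 0 ≤ kahanStep F (x 0) s c (kahanVar F (fun i => x (i + 1)) n) := by
        have := kahanStep_mono F (x 0) s c (g₁ := fun _ _ => (0 : K))
          (g₂ := kahanVar F (fun i => x (i + 1)) n) fun t c' => ih _ t c'
        rwa [kahanStep_const] at this
      exact add_nonneg hloc hst

/-- **Variance envelope.** If on every branch the y-, d-, c-ops have candidate gaps `≤ Gy, Gd, Gc`,
then `kahanVar ≤ n (Gy² + Gd² + Gc²)/4` — independent of the magnitude of the partial sums. -/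
theorem kahanVar_le (F : Finset K) (Gy Gd Gc : K) (x : ℕ → K) (n : ℕ) (s c : K)
    (h : GapK F Gy Gd Gc x n s c) : kahanVar F x n s c ≤ n * ((Gy ^ 2 + Gd ^ 2 + Gc ^ 2) / 4) := by
  induction n generalizing x s c with
  | zero => simp [kahanVar]
  | succ n ih =>
      obtain ⟨hs, hall⟩ := h
      simp only [kahanVar]
      have h1 := localVar_le hs
      have h2 : kahanStep F (x 0) s c (kahanVar F (fun i => x (i + 1)) n)
          ≤ n * ((Gy ^ 2 + Gd ^ 2 + Gc ^ 2) / 4) :=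
        kahanStep_le_of F _ _ _ (hall.mono fun t c' ht => ih _ t c' ht)
      push_cast
      linarith

/-! ### Chebyshev: the `√n` probabilistic envelope of the corrected sum -/

/-- **Bienaymé–Chebyshev for compensated summation under SR (exact-variance form).** If no small
operation saturates on any branch, `P(|sₙ − cₙ − (s − c + ∑ xₖ)| ≥ r) ≤ kahanVar / r²`. -/
theorem kahan_prob_dev_ge_le_kahanVar (F : Finset K) (x : ℕ → K) (n : ℕ) (s c : K)
    (h : NoSatK F x n s c) {r : K} (hr : 0 < r) :
    kahanExp F x n (fun s' c' => devInd r (s - c + ∑ i ∈ range n, x i) (s' - c')) s c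
      ≤ kahanVar F x n s c / r ^ 2 := by
  calc kahanExp F x n (fun s' c' => devInd r (s - c + ∑ i ∈ range n, x i) (s' - c')) s c
      ≤ kahanExp F x n (fun s' c' => (r ^ 2)⁻¹ * (s' - c' - (s - c + ∑ i ∈ range n, x i)) ^ 2)
          s c := kahanExp_mono F x n (fun s' c' => by
            rw [← div_eq_inv_mul]; exact devInd_le_sq_div r _ _ hr) s c
    _ = kahanVar F x n s c / r ^ 2 := by
        rw [kahanExp_mul_left, kahanExp_sq_sub_sum F x n s c h, div_eq_inv_mul]

/-- **The `√n` envelope at summand magnitude.** Without a saturating small operation and with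
candidate gaps `≤ Gy, Gd, Gc` on every branch: `P(|sₙ − cₙ − (s − c + ∑ xₖ)| ≥ r)
≤ n (Gy² + Gd² + Gc²)/(4 r²)`, i.e. error `< ½ √(n (Gy² + Gd² + Gc²)/λ)` with probability
`> 1 − λ`. -/
theorem kahan_prob_dev_ge_le (F : Finset K) (Gy Gd Gc : K) (x : ℕ → K) (n : ℕ) (s c : K)
    (h : NoSatK F x n s c) (hG : GapK F Gy Gd Gc x n s c) {r : K} (hr : 0 < r) :
    kahanExp F x n (fun s' c' => devInd r (s - c + ∑ i ∈ range n, x i) (s' - c')) s c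
      ≤ n * ((Gy ^ 2 + Gd ^ 2 + Gc ^ 2) / 4) / r ^ 2 :=
  (kahan_prob_dev_ge_le_kahanVar F x n s c h hr).trans
    (div_le_div_of_nonneg_right (kahanVar_le F Gy Gd Gc x n s c hG) (pow_pos hr 2).le)

/-! ### The sure bound is linear -/

/-- Both candidates of an in-hull value with candidate gap `≤ G` are within `G` of it. -/
theorem abs_cand_sub_le {F : Finset K} {e G : K} (he : InHull F e) (hG : cgap F e ≤ G) :
    OnBoth F e fun v => |v - e| ≤ G := by
  have hcl := clamp_eq_self he
  unfold cgap at hG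
  rw [hcl] at hG
  refine ⟨?_, ?_⟩
  · have := abs_roundUp_sub_le F (clamp F e)
    unfold up; rw [hcl] at this ⊢; exact this.trans hG
  · have := abs_roundDown_sub_le F (clamp F e)
    unfold dn; rw [hcl] at this ⊢; exact this.trans hG

/-- **Pathwise one-step error**: on every branch `|t − c' − (s − c + x)| ≤ Gy + Gd + Gc` (the
identity `t − c' = (s − c) + x + εʸ − εᵈ − εᶜ` with `|εʸ| ≤ Gy`, `|εᵈ| ≤ Gd`, `|εᶜ| ≤ Gc`). -/
theorem stepAll_err_le {F : Finset K} {x s c Gy Gd Gc : K}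
    (hH : StepSmall F (InHull F) (InHull F) (InHull F) x s c)
    (hG : StepSmall F (fun e => cgap F e ≤ Gy) (fun e => cgap F e ≤ Gd) (fun e => cgap F e ≤ Gc)
      x s c) : StepAll F x s c fun t c' => |t - c' - (s - c + x)| ≤ Gy + Gd + Gc := by
  obtain ⟨hy, hH2⟩ := hH
  obtain ⟨gy, hG2⟩ := hG
  refine ((abs_cand_sub_le hy gy).and (hH2.and hG2)).mono fun y hy' => ?_
  obtain ⟨ey, hy2, hy3⟩ := hy'
  refine (hy2.and hy3).mono fun t ht => ?_
  obtain ⟨⟨ht1, ht2⟩, gt1, gt2⟩ := ht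
  refine ((abs_cand_sub_le ht1 gt1).and (ht2.and gt2)).mono fun d hd => ?_
  obtain ⟨ed, hd2, hd3⟩ := hd
  refine (abs_cand_sub_le hd2 hd3).mono fun c' ec => ?_
  show |t - c' - (s - c + x)| ≤ Gy + Gd + Gc
  rw [show t - c' - (s - c + x) = (y - (x - c)) - (d - (t - s)) - (c' - (d - y)) by ring]
  calc |y - (x - c) - (d - (t - s)) - (c' - (d - y))|
      ≤ |y - (x - c) - (d - (t - s))| + |c' - (d - y)| := abs_sub _ _
    _ ≤ |y - (x - c)| + |d - (t - s)| + |c' - (d - y)| := by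
        linarith [abs_sub (y - (x - c)) (d - (t - s))]
    _ ≤ Gy + Gd + Gc := by linarith

/-- **The sure (worst-case) bound is linear**: on every branch
`|sₙ − cₙ − (s − c + ∑ xₖ)| ≤ n (Gy + Gd + Gc)`. -/
theorem leavesK_abs_sub_le (F : Finset K) (Gy Gd Gc : K) (x : ℕ → K) (n : ℕ) (s c : K)
    (h : NoSatK F x n s c) (hG : GapK F Gy Gd Gc x n s c) :
    LeavesK F x n (fun s' c' => |s' - c' - (s - c + ∑ i ∈ range n, x i)| ≤ n * (Gy + Gd + Gc))
      s c := by
  induction n generalizing x s c with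
  | zero => simp [LeavesK]
  | succ n ih =>
      obtain ⟨hs, hall⟩ := h
      obtain ⟨gs, gall⟩ := hG
      simp only [LeavesK]
      have herr := stepAll_err_le hs gs
      refine ((OnBoth.and herr (OnBoth.and hall gall)).mono fun y hy' => ?_)
      obtain ⟨e1, h1, g1⟩ := hy'
      refine (e1.and (h1.and g1)).mono fun t ht => ?_
      obtain ⟨e2, h2, g2⟩ := ht
      refine (e2.and (h2.and g2)).mono fun d hd => ?_
      obtain ⟨e3, h3, g3⟩ := hd
      refine (e3.and (h3.and g3)).mono fun c' hc => ?_
      obtain ⟨e4, h4, g4⟩ := hc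
      refine LeavesK.mono F _ n (fun s' c'' hv => ?_) _ _ (ih _ t c' h4 g4)
      rw [sum_range_succ']
      calc |s' - c'' - (s - c + (∑ i ∈ range n, x (i + 1) + x 0))|
          = |(s' - c'' - (t - c' + ∑ i ∈ range n, x (i + 1))) + (t - c' - (s - c + x 0))| := by
            ring_nf
        _ ≤ |s' - c'' - (t - c' + ∑ i ∈ range n, x (i + 1))| + |t - c' - (s - c + x 0)| :=
            abs_add_le _ _
        _ ≤ n * (Gy + Gd + Gc) + (Gy + Gd + Gc) := add_le_add hv e4
        _ = (↑(n + 1) : K) * (Gy + Gd + Gc) := by push_cast; ring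

end Summit.Ventures.CertifiedArithmetic.LowPrec.SR
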